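import Literature.AnabelianGeometry.EtaleTheta.SettingModelChiKummerData
import HarnessLib

/-!
# `log(U)`, `log(Ü)` from a `y`-coordinate crossed homomorphism — generic over a theta setting (R78 F6q prep)

Mochizuki, *The étale theta function …*, Publ. RIMS **45** (2009) [EtTh], §1, Prop. 1.5, PRIMS PDF p. 23
[cite: MochizukiEtTh2009, Prop 1.5 p.23]: "`log(U) ∈ H¹(Π^tp_Y, Δ_Θ)`", "`log(Ü)`", "`log(U)|_Ÿ = 2·log(Ü)`".

CLASS (b) CONSTRUCTION over the frozen interface (abc-iut cell, R78 cluster, seat abc-iut-w5-d171; no interface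
clause touched), abstracting the `y`-coordinate half of `SettingModelChiKummerData` (F6 (c) part 2b) so that the
STAGE-2 model (`modelχq`, Tate shear — where the crossed-homomorphism law holds on `(Π^tp_Y)^Θ` only, cf.
`SettingModelTateYCoord`) and any later model instantiate it in a few lines:

* `ThetaSetting.YCoordKit D` — a character `χ^Θ : (Π^tp_X)^Θ → Aut(Ẑ)`, a continuous `χ^Θ`-equivariant
  `ι : Ẑ → Δ_Θ`, and a continuous `ŷ : (Π^tp_X)^Θ → Ẑ` which is a `χ^Θ`-CROSSED HOMOMORPHISM ON `(Π^tp_Y)^Θ` and EVEN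
  on `(Π^tp_Ÿ)^Θ`;
* `YCoordKit.logU ∈ H¹((Π^tp_Y)^Θ, Δ_Θ)` (class of `h ↦ ι(ŷ h)`), `YCoordKit.logUdd ∈ H¹((Π^tp_Ÿ)^Θ, Δ_Θ)` (class of
  `h ↦ ι(ŷ h / 2)`, halving in the torsion-free `Ẑ`), and **`YCoordKit.res_logU : log(U)|_Ÿ = 2·log(Ü)`**.

Semi-synthetic use; nothing of [EtTh] asserted; no side taken on [IUTchIII] Cor. 3.12.
-/

noncomputable section

namespace Literature.AnabelianGeometry.EtaleTheta

open Literature.AnabelianGeometry.SemiGraphs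

namespace ThetaSetting

variable {p : ℕ} [Fact p.Prime] (D : ThetaSetting p)

/-- **`y`-coordinate kit** on a theta setting: the data from which `log(U)`, `log(Ü)` are built.
[cite: MochizukiEtTh2009, Prop 1.5 p.23] -/
structure YCoordKit where
  /-- the cyclotomic character through `(Π^tp_X)^Θ` -/
  chiT : D.GtpTheta →* MulAut SettingModel.ZH
  /-- `Ẑ → Δ_Θ` -/
  iota : SettingModel.ZH →* D.DeltaTheta
  continuous_iota : Continuous iota
  /-- `ι(χ^Θ(g) t) = g ι(t) g⁻¹` -/
  iota_chiT : ∀ (g : D.GtpTheta) (t : SettingModel.ZH), iota (chiT g t) = MulAut.conjNormal g (iota t)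
  /-- the `y`-coordinate -/
  y : D.GtpTheta → SettingModel.ZH
  continuous_y : Continuous y
  /-- crossed-homomorphism law ON `(Π^tp_Y)^Θ` -/
  y_mul : ∀ g ∈ D.GtpY.map D.toTheta, ∀ h ∈ D.GtpY.map D.toTheta, y (g * h) = y g * chiT g (y h)
  /-- evenness on `(Π^tp_Ÿ)^Θ` -/
  y_even : ∀ g ∈ D.GtpYdd.map D.toTheta, y g ∈ SettingModel.sqHom.range

namespace YCoordKit

variable {D} (K : D.YCoordKit)

/-- The `log(U)`-cocycle `h ↦ ι(ŷ h)` on `(Π^tp_Y)^Θ`. [cite: MochizukiEtTh2009, Prop 1.5 p.23] -/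
def logUFun : ↥(D.GtpY.map D.toTheta) → D.DeltaTheta := fun h => K.iota (K.y h)

/-- It is a continuous 1-cocycle. [cite: MochizukiEtTh2009, Prop 1.5 p.23] -/
theorem logUFun_mem :
    K.logUFun ∈ contCocycles (MonoidHom.id D.GtpTheta) D.DeltaTheta (D.GtpY.map D.toTheta) := by
  refine ⟨K.continuous_iota.comp (K.continuous_y.comp continuous_subtype_val), fun g h => ?_⟩
  show K.iota (K.y ((g : D.GtpTheta) * h)) =
    K.iota (K.y g) * MulAut.conjNormal ((MonoidHom.id _) (g : D.GtpTheta)) (K.iota (K.y h))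
  rw [K.y_mul g g.2 h h.2, map_mul, MonoidHom.id_apply, ← K.iota_chiT]

/-- **`log(U) ∈ H¹((Π^tp_Y)^Θ, Δ_Θ)`**. [cite: MochizukiEtTh2009, Prop 1.5 p.23] -/
def logU : D.H1Theta (D.GtpY.map D.toTheta) := ContH1.mk K.logUFun K.logUFun_mem

/-- The `log(Ü)`-cocycle `h ↦ ι(ŷ h / 2)` on `(Π^tp_Ÿ)^Θ`. [cite: MochizukiEtTh2009, Prop 1.5 p.23] -/
def logUddFun : ↥(D.GtpYdd.map D.toTheta) → D.DeltaTheta :=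
  fun h => K.iota (SettingModel.half ⟨K.y h, K.y_even h h.2⟩)

/-- It is a continuous 1-cocycle. [cite: MochizukiEtTh2009, Prop 1.5 p.23] -/
theorem logUddFun_mem :
    K.logUddFun ∈ contCocycles (MonoidHom.id D.GtpTheta) D.DeltaTheta (D.GtpYdd.map D.toTheta) := by
  refine ⟨K.continuous_iota.comp (SettingModel.continuous_half.comp
    ((K.continuous_y.comp continuous_subtype_val).subtype_mk _)), fun g h => ?_⟩
  show K.iota (SettingModel.half ⟨K.y ((g : D.GtpTheta) * h), _⟩) =
    K.iota (SettingModel.half ⟨K.y g, _⟩) *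
      MulAut.conjNormal ((MonoidHom.id _) (g : D.GtpTheta)) (K.iota (SettingModel.half ⟨K.y h, _⟩))
  rw [MonoidHom.id_apply, ← K.iota_chiT, ← map_mul, ← SettingModel.half_mulAut, ← map_mul]
  congr 1
  apply SettingModel.sqHom_injective
  rw [SettingModel.sqHom_apply, SettingModel.sqHom_apply, SettingModel.half_sq, SettingModel.half_sq]
  exact K.y_mul g (D.GtpYddTheta_le g.2) h (D.GtpYddTheta_le h.2)

/-- **`log(Ü) ∈ H¹((Π^tp_Ÿ)^Θ, Δ_Θ)`**. [cite: MochizukiEtTh2009, Prop 1.5 p.23] -/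
def logUdd : D.H1Theta (D.GtpYdd.map D.toTheta) := ContH1.mk K.logUddFun K.logUddFun_mem

/-- **`log(U)|_Ÿ = 2·log(Ü)`** (on cocycles: `ι(ŷ) = ι(ŷ/2)²`). [cite: MochizukiEtTh2009, Prop 1.5 p.23] -/
theorem res_logU :
    ContH1.res (MonoidHom.id D.GtpTheta) D.DeltaTheta D.GtpYddTheta_le K.logU = K.logUdd ^ 2 := by
  rw [logUdd, pow_two, ContH1.mk_mul_mk]
  refine ContH1.mk_congr _ (funext fun h => ?_) _ _
  show K.iota (K.y h) = K.iota (SettingModel.half ⟨K.y h, _⟩) * K.iota (SettingModel.half ⟨K.y h, _⟩)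
  rw [← map_mul, ← pow_two, SettingModel.half_sq]

/-- `log(U)` is non-trivial as soon as `ŷ(h) ≠ 0` at some `h ∈ (Π^tp_Y)^Θ` centralising `Δ_Θ` and `ι` is injective.
[cite: MochizukiEtTh2009, Prop 1.5 p.23] -/
theorem logU_ne_one (hinj : Function.Injective K.iota) {h : D.GtpTheta} (hh : h ∈ D.GtpY.map D.toTheta)
    (hcent : ∀ a : D.DeltaTheta, MulAut.conjNormal h a = a) (hy : K.y h ≠ 1) : K.logU ≠ 1 := by
  intro h0
  rw [logU, ← ContH1.mk_one] at h0
  obtain ⟨a, ha⟩ := (ContH1.mk_eq_mk_iff _ _ _ _ _).mp h0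
  have h1 := ha ⟨h, hh⟩
  rw [Pi.one_apply, mul_one, MonoidHom.id_apply] at h1
  have hcoe : ((⟨h, hh⟩ : ↥(D.GtpY.map D.toTheta)) : D.GtpTheta) = h := rfl
  rw [hcoe, hcent a, mul_inv_cancel, inv_eq_one] at h1
  exact hy (hinj (h1.trans (map_one K.iota).symm))

end YCoordKit

end ThetaSetting

end Literature.AnabelianGeometry.EtaleTheta

end
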